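import Mathlib.FieldTheory.Finiteness
import Mathlib.LinearAlgebra.Dimension.Constructions
import Literature.InformationTheory.QuantumCodes.SymplecticCodes
import Literature.InformationTheory.QuantumCodes.ParityCheckDuality
import Literature.InformationTheory.Coding.PerfectCodeWeightRecurrence
import HarnessLib

/-!
# The Gilbert–Varshamov bound for CSS codes (Matsumoto 2017, Lemma 1 and Theorem 1)

Topic `Literature/InformationTheory/QuantumCodes` (LADDER-QEC, LIT-1 custody: LOWER-bound column for CSS
codes). Everything here is PROVED (no named facts).

**Source.** R. Matsumoto, *Two Gilbert–Varshamov-type existential bounds for asymmetric quantum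
error-correcting codes*, Quantum Inf. Process. 16 (2017), no. 12, doi:10.1007/s11128-017-1748-y = arXiv:1705.04087 [Matsumoto2017], §2
(held text, chunk p0004). With `B_n` = the set of nested pairs `C₂ ⊂ C₁ ⊂ 𝔽_qⁿ` of dimensions
`k₁ > k₂` (the paper's naming; below we use the tree's CRSS naming `C₁ ≤ C₂`, i.e. the roles of the
indices are swapped) and `B_{n,x}(e)` (resp. `B_{n,z}(e)`) = the pairs with `e ∈ C₁ ∖ C₂` (resp.
`e ∈ C₂⊥ ∖ C₁⊥`):

> **Lemma 1.** For nonzero `e`, `|B_{n,x}(e)| = (q^{k₁} − q^{k₂})/(qⁿ − 1) · |B_n|` and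
> `|B_{n,z}(e)| = (q^{n−k₂} − q^{n−k₁})/(qⁿ − 1) · |B_n|`.

(proof: each pair has `q^{k₁} − q^{k₂}` undetectable bit errors, and `|B_{n,x}(e₁)| = |B_{n,x}(e₂)|`
because `GL_n(𝔽_q)` acts transitively on nonzero vectors and on `B_n`; "for phase errors, we can make
a similar argument")

> **Theorem 1.** If `(q^{k₁} − q^{k₂})/(qⁿ−1) · Σ_{i=1}^{d_x−1} C(n,i)(q−1)^i +
> (q^{n−k₂} − q^{n−k₁})/(qⁿ−1) · Σ_{i=1}^{d_z−1} C(n,i)(q−1)^i < 1`, then an `[[n, k₁ − k₂, d_x, d_z]]_q`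
> CSS code exists.

**What is proved here** (`q = 2`; tree naming `C₁ ≤ C₂ ≤ 𝔽₂ⁿ`, `dim C₁ = k₁ ≤ k₂ = dim C₂`,
bit errors `C₂ ∖ C₁`, phase errors `C₁⊥ ∖ C₂⊥`, as in `cssSpace C₁ C₂ = C₁ × C₂⊥` and
`CRSS1998_theorem9_css`):

* transitivity of `GL_n(𝔽₂)` on nonzero vectors by the involutions `x ↦ x + (w·x) z` (`shear`,
  `exists_shear_apply_eq`), with the adjunction `(g x)·e = x·(gᵀ e)` (`shear_dotProduct`);
* nested pairs parametrised by linearly independent `k₂`-frames `T` (`C₂ = span T`,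
  `C₁ = span (T ∘ castLE)`); Lemma 1 as the two exact double counts
  `X(e)·(2ⁿ − 1) = #frames·(2^{k₂} − 2^{k₁})` (`cssCountX_mul_eq`) and
  `Z(e)·(2ⁿ − 1) = #frames·(2^{n−k₁} − 2^{n−k₂})` (`cssCountZ_mul_eq`);
* **Theorem 1** (`Matsumoto2017_theorem1_css`): if
  `(2^{k₂} − 2^{k₁})·#{e ≠ 0 : wt e < d_x} + (2^{n−k₁} − 2^{n−k₂})·#{e ≠ 0 : wt e < d_z} < 2ⁿ − 1`
  then there are `C₁ ≤ C₂ ≤ 𝔽₂ⁿ` of dimensions `k₁ ≤ k₂` with every word of `C₂ ∖ C₁` of weight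
  `≥ d_x` and every word of `C₁⊥ ∖ C₂⊥` of weight `≥ d_z` (here `#{e ≠ 0 : wt e < d} =
  Σ_{i=1}^{d−1} C(n,i)`); and the symmetric corollary through CRSS Thm. 9
  (`Matsumoto2017_theorem1_additive`): an `[[n, k₂ − k₁, min(d_x, d_z)]]` stabilizer code exists
  (`k₁ < k₂`); the same two statements with the printed binomial sums `Σ_{i=1}^{d−1} C(n,i)`
  (eq. (1) times `2ⁿ − 1`): `Matsumoto2017_theorem1`, `Matsumoto2017_theorem1_additiveCodeExists`
  (via `PerfectCode.card_filter_hammingNorm_eq`), and the symmetric special case `k₂ = n − k₁`,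
  `d_x = d_z`: `Matsumoto2017_theorem1_symmetric` (`[[n, n − 2k₁, d]]`).

Scope / honesty notes. Binary case only (the paper is over `𝔽_q`); the asymptotic Corollary 1 and
the stabilizer-code Theorem 2 of §3 are not typed here (the symmetric stabilizer GV bound is
`quantumGilbertVarshamov` in `QuantumGilbertVarshamov.lean`).

## Tree / Mathlib search

`lean search 'Gilbert|Varshamov'` (2026-08-27): classical `Coding/GilbertBound`,
`Coding/GilbertVarshamovDual(Binary)` (one code, or a code and its dual, by random systematic
matrices) and `QuantumCodes/QuantumGilbertVarshamov` (stabilizer codes); no nested-pair / CSS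
statement. Reused: `cssSpace`, `CRSS1998_theorem9_css_holds`, `Coding.dualCode`,
`finrank_dualCode` (`ParityCheckDuality.lean`), `finrank_span_eq_card`, `Module.card_eq_pow_finrank`.
-/

namespace Literature.InformationTheory.QuantumCodes

open Finset Module Coding

variable {n : ℕ}

/-! ### Shears: involutions of `𝔽₂ⁿ` generating a transitive action on nonzero vectors -/

/-- An element of `𝔽₂` that is not `1` is `0`. [folklore] -/
private theorem zmod2_eq_zero_of_ne_one {a : ZMod 2} (h : a ≠ 1) : a = 0 := by
  revert a; decide

/-- The **shear** `x ↦ x + (w·x) z` for `w·z = 0`: an involution of `𝔽₂ⁿ` (an element of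
`GL_n(𝔽₂)`). [cite: Matsumoto2017, §2 Lemma 1 proof (chunk p0004: "τ ∈ GL_n(F_q) such that τ' e₁ = e₂")] -/
def shear (w z : Fin n → ZMod 2) (h : w ⬝ᵥ z = 0) : (Fin n → ZMod 2) ≃ₗ[ZMod 2] (Fin n → ZMod 2) where
  toFun x := x + (w ⬝ᵥ x) • z
  map_add' x y := by rw [dotProduct_add, add_smul]; abel
  map_smul' c x := by rw [dotProduct_smul, smul_eq_mul, RingHom.id_apply, smul_add, smul_smul]
  invFun x := x + (w ⬝ᵥ x) • z
  left_inv x := by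
    simp only [dotProduct_add, dotProduct_smul, h, smul_eq_mul, mul_zero, add_zero]
    rw [add_assoc, ZModModule.add_self, add_zero]
  right_inv x := by
    simp only [dotProduct_add, dotProduct_smul, h, smul_eq_mul, mul_zero, add_zero]
    rw [add_assoc, ZModModule.add_self, add_zero]

/-- `shear w z x = x + (w·x) z`. [folklore] -/
private theorem shear_apply (w z : Fin n → ZMod 2) (h : w ⬝ᵥ z = 0) (x : Fin n → ZMod 2) :
    shear w z h x = x + (w ⬝ᵥ x) • z := rfl

/-- The adjunction `(shear w z x)·e = x·(shear z w e)` (transposed shear).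
[cite: Matsumoto2017, §2 Lemma 1 proof (chunk p0004: "For phase errors, we can make a similar argument with C₂⊥ ∖ C₁⊥")] -/
theorem shear_dotProduct (w z : Fin n → ZMod 2) (h : w ⬝ᵥ z = 0) (x e : Fin n → ZMod 2) :
    shear w z h x ⬝ᵥ e = x ⬝ᵥ shear z w (by rwa [dotProduct_comm]) e := by
  rw [shear_apply, shear_apply, add_dotProduct, dotProduct_add, smul_dotProduct, dotProduct_smul,
    smul_eq_mul, smul_eq_mul, dotProduct_comm w x, mul_comm]

/-- For nonzero `u, v ∈ 𝔽₂ⁿ` there is `w` with `w·u = w·v = 1`. [folklore] -/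
private theorem exists_dotProduct_eq_one_one {u v : Fin n → ZMod 2} (hu : u ≠ 0) (hv : v ≠ 0) :
    ∃ w : Fin n → ZMod 2, w ⬝ᵥ u = 1 ∧ w ⬝ᵥ v = 1 := by
  classical
  have key : ∀ {x : Fin n → ZMod 2}, x ≠ 0 → ∃ i, x i = 1 := by
    intro x hx
    by_contra h
    push Not at h
    exact hx (funext fun i => zmod2_eq_zero_of_ne_one (h i))
  obtain ⟨i, hi⟩ := key hu
  obtain ⟨j, hj⟩ := key hv
  by_cases hvi : v i = 1
  · exact ⟨Pi.single i 1, by rw [single_dotProduct, one_mul, hi], by rw [single_dotProduct, one_mul, hvi]⟩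
  by_cases huj : u j = 1
  · exact ⟨Pi.single j 1, by rw [single_dotProduct, one_mul, huj], by rw [single_dotProduct, one_mul, hj]⟩
  refine ⟨Pi.single i 1 + Pi.single j 1, ?_, ?_⟩
  · rw [add_dotProduct, single_dotProduct, single_dotProduct, one_mul, one_mul, hi,
      zmod2_eq_zero_of_ne_one huj, add_zero]
  · rw [add_dotProduct, single_dotProduct, single_dotProduct, one_mul, one_mul,
      zmod2_eq_zero_of_ne_one hvi, hj, zero_add]

/-- **`GL_n(𝔽₂)` is transitive on nonzero vectors**, realised by a single shear:
`shear w (u+v)` with `w·u = w·v = 1` maps `u ↦ v`.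
[cite: Matsumoto2017, §2 Lemma 1 proof (chunk p0004: "where τ' ∈ GL_n(F_q) such that τ' e₁ = e₂")] -/
theorem exists_shear_apply_eq {u v : Fin n → ZMod 2} (hu : u ≠ 0) (hv : v ≠ 0) :
    ∃ (w z : Fin n → ZMod 2) (h : w ⬝ᵥ z = 0), shear w z h u = v ∧ z ⬝ᵥ w = 0 := by
  obtain ⟨w, hwu, hwv⟩ := exists_dotProduct_eq_one_one hu hv
  have hwz : w ⬝ᵥ (u + v) = 0 := by rw [dotProduct_add, hwu, hwv]; decide
  refine ⟨w, u + v, hwz, ?_, by rwa [dotProduct_comm]⟩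
  rw [shear_apply, hwu, one_smul, ← add_assoc, ZModModule.add_self, zero_add]

/-! ### Nested frames and Lemma 1 -/

section Frames

open scoped Classical

variable (n) (k₁ k₂ : ℕ)

/-- The `k₂`-frames (linearly independent `k₂`-tuples) of `𝔽₂ⁿ`; a frame `T` carries the nested pair
`C₁ = span(T₀,…,T_{k₁−1}) ≤ C₂ = span(T)` (Matsumoto's `B_n`, counted through ordered bases).
[cite: Matsumoto2017, §2 (chunk p0004: "Let B_n = {(C₁, C₂) ∣ C₂ ⊂ C₁ ⊂ F_qⁿ, dim C₁ = k₁, dim C₂ = k₂}")] -/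
noncomputable def cssFrames : Finset (Fin k₂ → (Fin n → ZMod 2)) :=
  Finset.univ.filter fun T => LinearIndependent (ZMod 2) T

variable {n k₁ k₂}

/-- The larger code `C₂ = span T` of a frame. [cite: Matsumoto2017, §2 (chunk p0004)] -/
def bigCode (T : Fin k₂ → (Fin n → ZMod 2)) : Submodule (ZMod 2) (Fin n → ZMod 2) :=
  Submodule.span (ZMod 2) (Set.range T)

/-- The smaller code `C₁ = span(T₀,…,T_{k₁−1})` of a frame (`k₁ ≤ k₂`).
[cite: Matsumoto2017, §2 (chunk p0004)] -/
def smallCode (h : k₁ ≤ k₂) (T : Fin k₂ → (Fin n → ZMod 2)) : Submodule (ZMod 2) (Fin n → ZMod 2) :=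
  Submodule.span (ZMod 2) (Set.range fun i : Fin k₁ => T (Fin.castLE h i))

/-- `C₁ ≤ C₂`. [cite: Matsumoto2017, §2 (chunk p0004: "C₂ ⊂ C₁")] -/
theorem smallCode_le_bigCode (h : k₁ ≤ k₂) (T : Fin k₂ → (Fin n → ZMod 2)) :
    smallCode h T ≤ bigCode T := by
  refine Submodule.span_mono ?_
  rintro _ ⟨i, rfl⟩
  exact ⟨Fin.castLE h i, rfl⟩

/-- Membership in `cssFrames`. [folklore] -/
private theorem mem_cssFrames_iff {T : Fin k₂ → (Fin n → ZMod 2)} :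
    T ∈ cssFrames n k₂ ↔ LinearIndependent (ZMod 2) T := by
  simp [cssFrames]

/-- Frames are carried to frames by a linear automorphism. [folklore] -/
private theorem comp_mem_cssFrames_iff (g : (Fin n → ZMod 2) ≃ₗ[ZMod 2] (Fin n → ZMod 2))
    {T : Fin k₂ → (Fin n → ZMod 2)} : (fun i => g (T i)) ∈ cssFrames n k₂ ↔ T ∈ cssFrames n k₂ := by
  rw [mem_cssFrames_iff, mem_cssFrames_iff]
  exact (g : (Fin n → ZMod 2) →ₗ[ZMod 2] (Fin n → ZMod 2)).linearIndependent_iff g.ker (v := T)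

/-- `span (g ∘ T) = g(span T)` on membership. [folklore] -/
private theorem mem_span_comp_iff (g : (Fin n → ZMod 2) ≃ₗ[ZMod 2] (Fin n → ZMod 2))
    {ι : Type*} (T : ι → (Fin n → ZMod 2)) (v : Fin n → ZMod 2) :
    g v ∈ Submodule.span (ZMod 2) (Set.range fun i => g (T i)) ↔
      v ∈ Submodule.span (ZMod 2) (Set.range T) := by
  have hr : (Set.range fun i => g (T i)) = (g : (Fin n → ZMod 2) →ₗ[ZMod 2] (Fin n → ZMod 2)) '' Set.range T := by
    ext x; simp [Set.mem_range, Set.mem_image]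
  rw [hr, ← Submodule.map_span]
  constructor
  · intro h
    obtain ⟨y, hy, hgy⟩ := Submodule.mem_map.1 h
    rwa [← g.injective hgy]
  · exact fun h => Submodule.mem_map.2 ⟨v, h, rfl⟩

/-- Dimensions of the two codes of a frame. [folklore] -/
private theorem finrank_bigCode {T : Fin k₂ → (Fin n → ZMod 2)} (hT : T ∈ cssFrames n k₂) :
    finrank (ZMod 2) (bigCode T) = k₂ := by
  rw [bigCode, finrank_span_eq_card (mem_cssFrames_iff.1 hT), Fintype.card_fin]

/-- `dim C₁ = k₁`. [folklore] -/
private theorem finrank_smallCode (h : k₁ ≤ k₂) {T : Fin k₂ → (Fin n → ZMod 2)} (hT : T ∈ cssFrames n k₂) :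
    finrank (ZMod 2) (smallCode h T) = k₁ := by
  have hli : LinearIndependent (ZMod 2) fun i : Fin k₁ => T (Fin.castLE h i) :=
    (mem_cssFrames_iff.1 hT).comp _ (Fin.castLE_injective h)
  rw [smallCode, finrank_span_eq_card hli, Fintype.card_fin]

/-- `|C| = 2^{dim C}` as a filtered count. [folklore] -/
private theorem card_filter_mem (C : Submodule (ZMod 2) (Fin n → ZMod 2)) :
    #{v : Fin n → ZMod 2 | v ∈ C} = 2 ^ finrank (ZMod 2) C := by
  rw [← Fintype.card_subtype, Module.card_eq_pow_finrank (K := ZMod 2) (V := C), ZMod.card]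

/-- For nested `C₁ ≤ C₂`: `#(C₂ ∖ C₁) = 2^{dim C₂} − 2^{dim C₁}` ("each pair `C₂ ⊂ C₁` has
`q^{k₁} − q^{k₂}` undetectable errors"). [cite: Matsumoto2017, §2 Lemma 1 proof (chunk p0004)] -/
private theorem card_filter_mem_sdiff {C₁ C₂ : Submodule (ZMod 2) (Fin n → ZMod 2)} (h : C₁ ≤ C₂) :
    #{v : Fin n → ZMod 2 | v ∈ C₂ ∧ v ∉ C₁} =
      2 ^ finrank (ZMod 2) C₂ - 2 ^ finrank (ZMod 2) C₁ := by
  rw [← card_filter_mem C₂, ← card_filter_mem C₁]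
  have hsub : (Finset.univ.filter fun v : Fin n → ZMod 2 => v ∈ C₁) ⊆
      Finset.univ.filter fun v : Fin n → ZMod 2 => v ∈ C₂ := by
    intro v hv
    simp only [Finset.mem_filter, Finset.mem_univ, true_and] at hv ⊢
    exact h hv
  rw [← Finset.card_sdiff_of_subset hsub]
  congr 1
  ext v
  simp [Finset.mem_sdiff]

variable (n k₁ k₂)

/-- The frames for which `e` is an undetected BIT error: `e ∈ C₂ ∖ C₁` (Matsumoto's `B_{n,x}(e)`).
[cite: Matsumoto2017, §2 (chunk p0004: "B_{n,x}(e) = {(C₁, C₂) ∈ B_n ∣ e ∈ C₁ ∖ C₂}")] -/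
noncomputable def framesX (h : k₁ ≤ k₂) (e : Fin n → ZMod 2) : Finset (Fin k₂ → (Fin n → ZMod 2)) :=
  (cssFrames n k₂).filter fun T => e ∈ bigCode T ∧ e ∉ smallCode h T

/-- The frames for which `e` is an undetected PHASE error: `e ∈ C₁⊥ ∖ C₂⊥` (Matsumoto's
`B_{n,z}(e)`), written with the frame vectors: `e` is orthogonal to `T₀,…,T_{k₁−1}` but not to all
of `T`. [cite: Matsumoto2017, §2 (chunk p0004: "B_{n,z}(e) = {(C₁, C₂) ∈ B_n ∣ e ∈ C₂⊥ ∖ C₁⊥}")] -/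
noncomputable def framesZ (h : k₁ ≤ k₂) (e : Fin n → ZMod 2) : Finset (Fin k₂ → (Fin n → ZMod 2)) :=
  (cssFrames n k₂).filter fun T => (∀ i : Fin k₁, T (Fin.castLE h i) ⬝ᵥ e = 0) ∧ ¬ ∀ i, T i ⬝ᵥ e = 0

variable {n k₁ k₂}

/-- Orthogonality to a span is orthogonality to its generators. [folklore] -/
private theorem mem_dualCode_span_range_iff {ι : Type*} (T : ι → (Fin n → ZMod 2)) (e : Fin n → ZMod 2) :
    e ∈ dualCode (Submodule.span (ZMod 2) (Set.range T)) ↔ ∀ i, T i ⬝ᵥ e = 0 := by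
  rw [mem_dualCode_iff]
  constructor
  · exact fun hall i => hall _ (Submodule.subset_span ⟨i, rfl⟩)
  · intro hall c hc
    refine Submodule.span_induction (fun x hx => ?_) ?_ (fun x y _ _ hx hy => ?_) (fun a x _ hx => ?_) hc
    · obtain ⟨i, rfl⟩ := hx; exact hall i
    · exact zero_dotProduct e
    · rw [add_dotProduct, hx, hy, add_zero]
    · rw [smul_dotProduct, hx, smul_zero]

/-- `|B_{n,x}(e)|` does not depend on the nonzero vector `e` (transitivity of `GL_n`).
[cite: Matsumoto2017, §2 Lemma 1 proof (chunk p0004: "we claim |B_{n,x}(e₁)| = |B_{n,x}(e₂)|")] -/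
theorem card_framesX_eq (h : k₁ ≤ k₂) {u v : Fin n → ZMod 2} (hu : u ≠ 0) (hv : v ≠ 0) :
    #(framesX n k₁ k₂ h u) = #(framesX n k₁ k₂ h v) := by
  obtain ⟨w, z, hwz, hg, -⟩ := exists_shear_apply_eq hu hv
  set g := shear w z hwz with hgdef
  refine Finset.card_bij' (fun T _ => fun i => g (T i)) (fun T _ => fun i => g.symm (T i))
    (fun T hT => ?_) (fun T hT => ?_) (fun T _ => funext fun i => g.symm_apply_apply (T i))
    (fun T _ => funext fun i => g.apply_symm_apply (T i))
  · rw [framesX, Finset.mem_filter] at hT ⊢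
    refine ⟨(comp_mem_cssFrames_iff g).2 hT.1, ?_, ?_⟩
    · rw [← hg, bigCode, mem_span_comp_iff]; exact hT.2.1
    · rw [← hg, smallCode, mem_span_comp_iff g (fun i : Fin k₁ => T (Fin.castLE h i))]; exact hT.2.2
  · rw [framesX, Finset.mem_filter] at hT ⊢
    have h1 : (fun i => g (g.symm (T i))) = T := funext fun i => g.apply_symm_apply (T i)
    refine ⟨(comp_mem_cssFrames_iff g).1 (by rw [h1]; exact hT.1), ?_, ?_⟩
    · have := hT.2.1
      rw [← h1, ← hg, bigCode, mem_span_comp_iff] at this; exact this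
    · have := hT.2.2
      rw [← h1, ← hg, smallCode, mem_span_comp_iff g (fun i : Fin k₁ => g.symm (T (Fin.castLE h i)))] at this
      exact this

/-- `|B_{n,z}(e)|` does not depend on the nonzero vector `e` (transitivity of `GL_n` through the
transposed action). [cite: Matsumoto2017, §2 Lemma 1 proof (chunk p0004: "For phase errors, we can make a similar argument")] -/
theorem card_framesZ_eq (h : k₁ ≤ k₂) {u v : Fin n → ZMod 2} (hu : u ≠ 0) (hv : v ≠ 0) :
    #(framesZ n k₁ k₂ h u) = #(framesZ n k₁ k₂ h v) := by
  -- a shear `g' = shear z w` with `g' v = u`; then `g := shear w z` satisfies `(g x)·v = x·u`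
  obtain ⟨z, w, hzw, hg', hwz⟩ := exists_shear_apply_eq hv hu
  have key : ∀ x : Fin n → ZMod 2, shear w z hwz x ⬝ᵥ v = x ⬝ᵥ u := by
    intro x
    rw [shear_dotProduct, ← hg']
  set g := shear w z hwz with hgdef
  refine Finset.card_bij' (fun T _ => fun i => g (T i)) (fun T _ => fun i => g.symm (T i))
    (fun T hT => ?_) (fun T hT => ?_) (fun T _ => funext fun i => g.symm_apply_apply (T i))
    (fun T _ => funext fun i => g.apply_symm_apply (T i))
  · rw [framesZ, Finset.mem_filter] at hT ⊢
    refine ⟨(comp_mem_cssFrames_iff g).2 hT.1, fun i => by rw [key]; exact hT.2.1 i, fun hall => hT.2.2 ?_⟩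
    intro i
    rw [← key]; exact hall i
  · rw [framesZ, Finset.mem_filter] at hT ⊢
    have h1 : (fun i => g (g.symm (T i))) = T := funext fun i => g.apply_symm_apply (T i)
    refine ⟨(comp_mem_cssFrames_iff g).1 (by rw [h1]; exact hT.1), fun i => ?_, fun hall => hT.2.2 ?_⟩
    · have := hT.2.1 i
      rw [← congrFun h1 (Fin.castLE h i), key] at this
      exact this
    · intro i
      have := hall i
      rw [← congrFun h1 i, key]
      exact this

/-- The number of nonzero vectors of `𝔽₂ⁿ` is `2ⁿ − 1`. [folklore] -/
private theorem card_filter_ne_zero : #{v : Fin n → ZMod 2 | v ≠ 0} = 2 ^ n - 1 := by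
  rw [Finset.filter_ne' Finset.univ (0 : Fin n → ZMod 2), Finset.card_erase_of_mem (Finset.mem_univ _),
    Finset.card_univ, Fintype.card_fun, ZMod.card, Fintype.card_fin]

/-- **Lemma 1, bit errors** (`q = 2`): for every `e ≠ 0`,
`|B_{n,x}(e)| · (2ⁿ − 1) = |B_n| · (2^{k₂} − 2^{k₁})`.
[cite: Matsumoto2017, §2 Lemma 1 (chunk p0004: "|B_{n,x}(e)| = (q^{k₁} − q^{k₂})/(qⁿ − 1) |B_n|")] -/
theorem cssCountX_mul_eq (h : k₁ ≤ k₂) {e : Fin n → ZMod 2} (he : e ≠ 0) :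
    #(framesX n k₁ k₂ h e) * (2 ^ n - 1) = #(cssFrames n k₂) * (2 ^ k₂ - 2 ^ k₁) := by
  have hsum : ∑ u ∈ (Finset.univ.filter fun u : Fin n → ZMod 2 => u ≠ 0), #(framesX n k₁ k₂ h u) =
      ∑ T ∈ cssFrames n k₂, #{u : Fin n → ZMod 2 | u ∈ bigCode T ∧ u ∉ smallCode h T} := by
    simp only [framesX, Finset.card_filter]
    rw [Finset.sum_comm]
    refine Finset.sum_congr rfl fun T _ => ?_
    rw [Finset.sum_filter]
    refine Finset.sum_congr rfl fun u _ => ?_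
    by_cases hu : u = 0
    · subst hu
      have : (0 : Fin n → ZMod 2) ∈ smallCode h T := Submodule.zero_mem _
      simp [this]
    · simp [hu]
  have hL : ∑ u ∈ (Finset.univ.filter fun u : Fin n → ZMod 2 => u ≠ 0), #(framesX n k₁ k₂ h u) =
      #(framesX n k₁ k₂ h e) * (2 ^ n - 1) := by
    rw [Finset.sum_const_nat (m := #(framesX n k₁ k₂ h e)) fun u hu =>
      card_framesX_eq h (Finset.mem_filter.1 hu).2 he, card_filter_ne_zero, mul_comm]
  have hR : ∑ T ∈ cssFrames n k₂, #{u : Fin n → ZMod 2 | u ∈ bigCode T ∧ u ∉ smallCode h T} =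
      #(cssFrames n k₂) * (2 ^ k₂ - 2 ^ k₁) := by
    rw [Finset.sum_const_nat (m := 2 ^ k₂ - 2 ^ k₁) fun T hT => ?_]
    rw [card_filter_mem_sdiff (smallCode_le_bigCode h T), finrank_bigCode hT, finrank_smallCode h hT]
  rw [← hL, hsum, hR]

/-- **Lemma 1, phase errors** (`q = 2`): for every `e ≠ 0`,
`|B_{n,z}(e)| · (2ⁿ − 1) = |B_n| · (2^{n−k₁} − 2^{n−k₂})`.
[cite: Matsumoto2017, §2 Lemma 1 (chunk p0004: "|B_{n,z}(e)| = (q^{n−k₂} − q^{n−k₁})/(qⁿ − 1) |B_n|")] -/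
theorem cssCountZ_mul_eq (h : k₁ ≤ k₂) {e : Fin n → ZMod 2} (he : e ≠ 0) :
    #(framesZ n k₁ k₂ h e) * (2 ^ n - 1) = #(cssFrames n k₂) * (2 ^ (n - k₁) - 2 ^ (n - k₂)) := by
  have hsum : ∑ u ∈ (Finset.univ.filter fun u : Fin n → ZMod 2 => u ≠ 0), #(framesZ n k₁ k₂ h u) =
      ∑ T ∈ cssFrames n k₂,
        #{u : Fin n → ZMod 2 | u ∈ dualCode (smallCode h T) ∧ u ∉ dualCode (bigCode T)} := by
    simp only [framesZ, Finset.card_filter]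
    rw [Finset.sum_comm]
    refine Finset.sum_congr rfl fun T _ => ?_
    rw [Finset.sum_filter]
    refine Finset.sum_congr rfl fun u _ => ?_
    have e1 : (∀ i : Fin k₁, T (Fin.castLE h i) ⬝ᵥ u = 0) ↔ u ∈ dualCode (smallCode h T) :=
      (mem_dualCode_span_range_iff _ u).symm
    have e2 : (∀ i, T i ⬝ᵥ u = 0) ↔ u ∈ dualCode (bigCode T) := (mem_dualCode_span_range_iff _ u).symm
    by_cases hu : u = 0
    · subst hu
      have : (0 : Fin n → ZMod 2) ∈ dualCode (bigCode T) := Submodule.zero_mem _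
      simp [this]
    · simp [hu, e1, e2]
  have hL : ∑ u ∈ (Finset.univ.filter fun u : Fin n → ZMod 2 => u ≠ 0), #(framesZ n k₁ k₂ h u) =
      #(framesZ n k₁ k₂ h e) * (2 ^ n - 1) := by
    rw [Finset.sum_const_nat (m := #(framesZ n k₁ k₂ h e)) fun u hu =>
      card_framesZ_eq h (Finset.mem_filter.1 hu).2 he, card_filter_ne_zero, mul_comm]
  have hR : ∑ T ∈ cssFrames n k₂,
      #{u : Fin n → ZMod 2 | u ∈ dualCode (smallCode h T) ∧ u ∉ dualCode (bigCode T)} =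
      #(cssFrames n k₂) * (2 ^ (n - k₁) - 2 ^ (n - k₂)) := by
    rw [Finset.sum_const_nat (m := 2 ^ (n - k₁) - 2 ^ (n - k₂)) fun T hT => ?_]
    have hanti : dualCode (bigCode T) ≤ dualCode (smallCode h T) := by
      intro u hu
      rw [mem_dualCode_iff] at hu ⊢
      exact fun c hc => hu c (smallCode_le_bigCode h T hc)
    rw [card_filter_mem_sdiff hanti, finrank_dualCode, finrank_dualCode, Fintype.card_fin,
      finrank_bigCode hT, finrank_smallCode h hT]
  rw [← hL, hsum, hR]

/-- Frames exist (`k₂ ≤ n`): the standard basis vectors `e_0, …, e_{k₂−1}`. [folklore] -/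
private theorem cssFrames_nonempty (hk : k₂ ≤ n) : (cssFrames n k₂).Nonempty := by
  refine ⟨fun i => Pi.single (Fin.castLE hk i) 1, mem_cssFrames_iff.2 ?_⟩
  have hb := (Pi.basisFun (ZMod 2) (Fin n)).linearIndependent
  have hcomp := hb.comp (Fin.castLE hk) (Fin.castLE_injective hk)
  convert hcomp using 1
  funext i
  simp [Pi.basisFun_apply]

/-! ### Theorem 1 -/

/-- The BAD frames: some nonzero `e` of weight `< d_x` in `C₂ ∖ C₁`, or of weight `< d_z` in
`C₁⊥ ∖ C₂⊥`. [cite: Matsumoto2017, §2 Thm. 1 proof (chunk p0004)] -/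
noncomputable def badCssFrames (n k₁ k₂ dx dz : ℕ) (h : k₁ ≤ k₂) : Finset (Fin k₂ → (Fin n → ZMod 2)) :=
  (cssFrames n k₂).filter fun T => ∃ e : Fin n → ZMod 2, e ≠ 0 ∧
    ((hammingNorm e < dx ∧ (e ∈ bigCode T ∧ e ∉ smallCode h T)) ∨
     (hammingNorm e < dz ∧ ((∀ i : Fin k₁, T (Fin.castLE h i) ⬝ᵥ e = 0) ∧ ¬ ∀ i, T i ⬝ᵥ e = 0)))

/-- **Union bound**: `#bad · (2ⁿ − 1) ≤ |B_n| · [(2^{k₂} − 2^{k₁}) V_x + (2^{n−k₁} − 2^{n−k₂}) V_z]`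
with `V_• = #{e ≠ 0 : wt e < d_•}`. [cite: Matsumoto2017, §2 Thm. 1 proof (chunk p0004: "if Eq. (1) holds then there exists at least one (C₁, C₂) ∈ B_n")] -/
theorem card_badCssFrames_mul_le (h : k₁ ≤ k₂) (dx dz : ℕ) :
    #(badCssFrames n k₁ k₂ dx dz h) * (2 ^ n - 1) ≤
      #(cssFrames n k₂) * ((2 ^ k₂ - 2 ^ k₁) * #{e : Fin n → ZMod 2 | e ≠ 0 ∧ hammingNorm e < dx} +
        (2 ^ (n - k₁) - 2 ^ (n - k₂)) * #{e : Fin n → ZMod 2 | e ≠ 0 ∧ hammingNorm e < dz}) := by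
  set Bx := Finset.univ.filter fun e : Fin n → ZMod 2 => e ≠ 0 ∧ hammingNorm e < dx
  set Bz := Finset.univ.filter fun e : Fin n → ZMod 2 => e ≠ 0 ∧ hammingNorm e < dz
  have hsub : badCssFrames n k₁ k₂ dx dz h ⊆
      (Bx.biUnion fun e => framesX n k₁ k₂ h e) ∪ Bz.biUnion fun e => framesZ n k₁ k₂ h e := by
    intro T hT
    rw [badCssFrames, Finset.mem_filter] at hT
    obtain ⟨hTf, e, he0, hcase⟩ := hT
    rw [Finset.mem_union, Finset.mem_biUnion, Finset.mem_biUnion]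
    rcases hcase with ⟨hw, hmem⟩ | ⟨hw, hmem⟩
    · exact Or.inl ⟨e, Finset.mem_filter.2 ⟨Finset.mem_univ _, he0, hw⟩,
        Finset.mem_filter.2 ⟨hTf, hmem⟩⟩
    · exact Or.inr ⟨e, Finset.mem_filter.2 ⟨Finset.mem_univ _, he0, hw⟩,
        Finset.mem_filter.2 ⟨hTf, hmem⟩⟩
  rcases (Finset.univ.filter fun v : Fin n → ZMod 2 => v ≠ 0).eq_empty_or_nonempty with h0 | ⟨e₀, he₀⟩
  · -- `n = 0`: no nonzero vectors, nothing is bad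
    have hBx : Bx = ∅ := Finset.eq_empty_iff_forall_notMem.2 fun e he =>
      (Finset.eq_empty_iff_forall_notMem.1 h0) e
        (Finset.mem_filter.2 ⟨Finset.mem_univ _, (Finset.mem_filter.1 he).2.1⟩)
    have hBz : Bz = ∅ := Finset.eq_empty_iff_forall_notMem.2 fun e he =>
      (Finset.eq_empty_iff_forall_notMem.1 h0) e
        (Finset.mem_filter.2 ⟨Finset.mem_univ _, (Finset.mem_filter.1 he).2.1⟩)
    rw [hBx, hBz, Finset.biUnion_empty, Finset.biUnion_empty, Finset.union_empty] at hsub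
    rw [Finset.subset_empty.1 hsub]
    simp
  · have he₀' : e₀ ≠ 0 := (Finset.mem_filter.1 he₀).2
    calc #(badCssFrames n k₁ k₂ dx dz h) * (2 ^ n - 1)
        ≤ #((Bx.biUnion fun e => framesX n k₁ k₂ h e) ∪ Bz.biUnion fun e => framesZ n k₁ k₂ h e) *
            (2 ^ n - 1) := Nat.mul_le_mul_right _ (Finset.card_le_card hsub)
      _ ≤ (#(Bx.biUnion fun e => framesX n k₁ k₂ h e) + #(Bz.biUnion fun e => framesZ n k₁ k₂ h e)) *
            (2 ^ n - 1) := Nat.mul_le_mul_right _ (Finset.card_union_le _ _)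
      _ ≤ ((∑ e ∈ Bx, #(framesX n k₁ k₂ h e)) + ∑ e ∈ Bz, #(framesZ n k₁ k₂ h e)) * (2 ^ n - 1) :=
          Nat.mul_le_mul_right _ (Nat.add_le_add Finset.card_biUnion_le Finset.card_biUnion_le)
      _ = #Bx * (#(framesX n k₁ k₂ h e₀) * (2 ^ n - 1)) + #Bz * (#(framesZ n k₁ k₂ h e₀) * (2 ^ n - 1)) := by
          rw [Finset.sum_const_nat (m := #(framesX n k₁ k₂ h e₀)) fun e he =>
              card_framesX_eq h (Finset.mem_filter.1 he).2.1 he₀',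
            Finset.sum_const_nat (m := #(framesZ n k₁ k₂ h e₀)) fun e he =>
              card_framesZ_eq h (Finset.mem_filter.1 he).2.1 he₀']
          ring
      _ = #(cssFrames n k₂) * ((2 ^ k₂ - 2 ^ k₁) * #Bx + (2 ^ (n - k₁) - 2 ^ (n - k₂)) * #Bz) := by
          rw [cssCountX_mul_eq h he₀', cssCountZ_mul_eq h he₀']
          ring

/-- **Theorem 1 (Matsumoto), binary CSS Gilbert–Varshamov bound.** Let `k₁ ≤ k₂ ≤ n` and suppose
`(2^{k₂} − 2^{k₁})·#{e ≠ 0 : wt e < d_x} + (2^{n−k₁} − 2^{n−k₂})·#{e ≠ 0 : wt e < d_z} < 2ⁿ − 1`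
(equivalently the printed `(2^{k₂}−2^{k₁})/(2ⁿ−1)·Σ_{i=1}^{d_x−1} C(n,i) +
(2^{n−k₁}−2^{n−k₂})/(2ⁿ−1)·Σ_{i=1}^{d_z−1} C(n,i) < 1`). Then there are binary linear codes
`C₁ ≤ C₂ ≤ 𝔽₂ⁿ` with `dim C₁ = k₁`, `dim C₂ = k₂`, every word of `C₂ ∖ C₁` of weight `≥ d_x` and every
word of `C₁⊥ ∖ C₂⊥` of weight `≥ d_z` — a CSS code `[[n, k₂ − k₁, d_x / d_z]]`.
[cite: Matsumoto2017, §2 Thm. 1 (arXiv:1705.04087 chunk p0004: "then an [[n, k₁ − k₂, d_x, d_z]]_q CSS QECC exists")] -/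
theorem Matsumoto2017_theorem1_css {n k₁ k₂ dx dz : ℕ} (h : k₁ ≤ k₂) (hk : k₂ ≤ n)
    (hgv : (2 ^ k₂ - 2 ^ k₁) * #{e : Fin n → ZMod 2 | e ≠ 0 ∧ hammingNorm e < dx} +
        (2 ^ (n - k₁) - 2 ^ (n - k₂)) * #{e : Fin n → ZMod 2 | e ≠ 0 ∧ hammingNorm e < dz} <
      2 ^ n - 1) :
    ∃ C₁ C₂ : Submodule (ZMod 2) (Fin n → ZMod 2), C₁ ≤ C₂ ∧
      finrank (ZMod 2) C₁ = k₁ ∧ finrank (ZMod 2) C₂ = k₂ ∧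
      (∀ c ∈ C₂, c ∉ C₁ → dx ≤ hammingNorm c) ∧
      (∀ c ∈ dualCode C₁, c ∉ dualCode C₂ → dz ≤ hammingNorm c) := by
  classical
  have hF : 0 < #(cssFrames n k₂) := Finset.card_pos.2 (cssFrames_nonempty hk)
  -- the union bound leaves a good frame
  have hlt : #(badCssFrames n k₁ k₂ dx dz h) < #(cssFrames n k₂) := by
    have hle := card_badCssFrames_mul_le (n := n) h dx dz
    have h' := Nat.mul_lt_mul_of_pos_left hgv hF
    exact Nat.lt_of_mul_lt_mul_right (lt_of_le_of_lt hle h')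
  obtain ⟨T, hT, hgood⟩ : ∃ T ∈ cssFrames n k₂, T ∉ badCssFrames n k₁ k₂ dx dz h := by
    by_contra hall
    push Not at hall
    exact (Nat.lt_irrefl _) (lt_of_lt_of_le hlt (Finset.card_le_card fun T hT => hall T hT))
  refine ⟨smallCode h T, bigCode T, smallCode_le_bigCode h T, finrank_smallCode h hT,
    finrank_bigCode hT, fun c hc2 hc1 => ?_, fun c hc1 hc2 => ?_⟩
  · by_contra hlt'
    have hc0 : c ≠ 0 := fun h0 => hc1 (h0 ▸ Submodule.zero_mem _)
    exact hgood (Finset.mem_filter.2 ⟨hT, c, hc0, Or.inl ⟨Nat.lt_of_not_le hlt', hc2, hc1⟩⟩)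
  · by_contra hlt'
    have hc0 : c ≠ 0 := fun h0 => hc2 (h0 ▸ Submodule.zero_mem _)
    refine hgood (Finset.mem_filter.2 ⟨hT, c, hc0, Or.inr ⟨Nat.lt_of_not_le hlt', ?_, ?_⟩⟩)
    · exact (mem_dualCode_span_range_iff _ c).1 hc1
    · exact fun hall => hc2 ((mem_dualCode_span_range_iff _ c).2 hall)

/-- **The symmetric corollary as a stabilizer code**: under the hypothesis of Theorem 1 with
`k₁ < k₂`, an `[[n, k₂ − k₁, min(d_x, d_z)]]` additive code exists (CRSS Thm. 9 applied to the pair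
`C₁ ≤ C₂`). [cite: Matsumoto2017, §2 Thm. 1 (chunk p0004); CalderbankEtAl1998, §5 Thm. 9 (printed p. 15)] -/
theorem Matsumoto2017_theorem1_additive {n k₁ k₂ dx dz : ℕ} (h : k₁ < k₂) (hk : k₂ ≤ n)
    (hgv : (2 ^ k₂ - 2 ^ k₁) * #{e : Fin n → ZMod 2 | e ≠ 0 ∧ hammingNorm e < dx} +
        (2 ^ (n - k₁) - 2 ^ (n - k₂)) * #{e : Fin n → ZMod 2 | e ≠ 0 ∧ hammingNorm e < dz} <
      2 ^ n - 1) :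
    AdditiveCodeExists n (k₂ - k₁) (min dx dz) := by
  obtain ⟨C₁, C₂, h12, hk1, hk2, hX, hZ⟩ := Matsumoto2017_theorem1_css h.le hk hgv
  obtain ⟨hself, hdim, hdist⟩ := CRSS1998_theorem9_css_holds n C₁ C₂ h12
  refine ⟨cssSpace C₁ C₂, hself, by rw [hk1, hk2] at hdim; omega, ?_, fun hk0 => by omega⟩
  exact (hdist (min dx dz)).2
    ⟨fun c hc hc' => (min_le_left _ _).trans (hX c hc hc'),
      fun c hc hc' => (min_le_right _ _).trans (hZ c hc hc')⟩

/-! ### Theorem 1 in its printed form (binomial sums) -/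

/-- `#{e ≠ 0 : wt e < d} = Σ_{i=1}^{d−1} C(n,i)` (sort the words by weight; `#{wt = i} = C(n,i)` is
`PerfectCode.card_filter_hammingNorm_eq`). [folklore] -/
private theorem card_filter_ne_zero_hammingNorm_lt (d : ℕ) :
    #{e : Fin n → ZMod 2 | e ≠ 0 ∧ hammingNorm e < d} = ∑ i ∈ Finset.Ico 1 d, n.choose i := by
  have hset : (Finset.univ.filter fun e : Fin n → ZMod 2 => e ≠ 0 ∧ hammingNorm e < d) =
      (Finset.Ico 1 d).biUnion fun i =>
        Finset.univ.filter fun e : Fin n → ZMod 2 => hammingNorm e = i := by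
    ext e
    simp only [Finset.mem_filter, Finset.mem_univ, true_and, Finset.mem_biUnion, Finset.mem_Ico]
    constructor
    · rintro ⟨h0, hd⟩
      exact ⟨hammingNorm e, ⟨Nat.one_le_iff_ne_zero.2 fun h => h0 (hammingNorm_eq_zero.1 h), hd⟩, rfl⟩
    · rintro ⟨i, ⟨h1, hid⟩, hi⟩
      refine ⟨fun h => ?_, hi ▸ hid⟩
      rw [h, hammingNorm_zero] at hi
      omega
  rw [hset, Finset.card_biUnion]
  · exact Finset.sum_congr rfl fun i _ => by
      rw [PerfectCode.card_filter_hammingNorm_eq, Fintype.card_fin]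
  · intro i _ j _ hij
    exact Finset.disjoint_filter.2 fun e _ hi hj => hij (hi.symm.trans hj)

/-- **Theorem 1 (Matsumoto) as printed** (`q = 2`, eq. (1) multiplied by `2ⁿ − 1`): if
`(2^{k₂} − 2^{k₁})·Σ_{i=1}^{d_x−1} C(n,i) + (2^{n−k₁} − 2^{n−k₂})·Σ_{i=1}^{d_z−1} C(n,i) < 2ⁿ − 1`
and `k₁ ≤ k₂ ≤ n`, then nested binary codes `C₁ ≤ C₂` of dimensions `k₁, k₂` exist with
`wt(C₂ ∖ C₁) ≥ d_x` and `wt(C₁⊥ ∖ C₂⊥) ≥ d_z` (an `[[n, k₂ − k₁, d_x / d_z]]` CSS code).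
[cite: Matsumoto2017, §2 Thm. 1 eq. (1) (arXiv:1705.04087 chunk p0004: "(q^{k₁}−q^{k₂})/(qⁿ−1) Σ_{i=1}^{d_x−1} C(n,i)(q−1)^i + (q^{n−k₂}−q^{n−k₁})/(qⁿ−1) Σ_{i=1}^{d_z−1} C(n,i)(q−1)^i < 1")] -/
theorem Matsumoto2017_theorem1 {n k₁ k₂ dx dz : ℕ} (h : k₁ ≤ k₂) (hk : k₂ ≤ n)
    (hgv : (2 ^ k₂ - 2 ^ k₁) * ∑ i ∈ Finset.Ico 1 dx, n.choose i +
        (2 ^ (n - k₁) - 2 ^ (n - k₂)) * ∑ i ∈ Finset.Ico 1 dz, n.choose i < 2 ^ n - 1) :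
    ∃ C₁ C₂ : Submodule (ZMod 2) (Fin n → ZMod 2), C₁ ≤ C₂ ∧
      finrank (ZMod 2) C₁ = k₁ ∧ finrank (ZMod 2) C₂ = k₂ ∧
      (∀ c ∈ C₂, c ∉ C₁ → dx ≤ hammingNorm c) ∧
      (∀ c ∈ dualCode C₁, c ∉ dualCode C₂ → dz ≤ hammingNorm c) :=
  Matsumoto2017_theorem1_css h hk (by rwa [card_filter_ne_zero_hammingNorm_lt, card_filter_ne_zero_hammingNorm_lt])

/-- **The printed Theorem 1, symmetric stabilizer form**: under eq. (1) (times `2ⁿ − 1`) with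
`k₁ < k₂ ≤ n`, an `[[n, k₂ − k₁, min(d_x, d_z)]]` additive code exists.
[cite: Matsumoto2017, §2 Thm. 1 eq. (1) (chunk p0004); CalderbankEtAl1998, §5 Thm. 9 (printed p. 15)] -/
theorem Matsumoto2017_theorem1_additiveCodeExists {n k₁ k₂ dx dz : ℕ} (h : k₁ < k₂) (hk : k₂ ≤ n)
    (hgv : (2 ^ k₂ - 2 ^ k₁) * ∑ i ∈ Finset.Ico 1 dx, n.choose i +
        (2 ^ (n - k₁) - 2 ^ (n - k₂)) * ∑ i ∈ Finset.Ico 1 dz, n.choose i < 2 ^ n - 1) :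
    AdditiveCodeExists n (k₂ - k₁) (min dx dz) :=
  Matsumoto2017_theorem1_additive h hk
    (by rwa [card_filter_ne_zero_hammingNorm_lt, card_filter_ne_zero_hammingNorm_lt])

/-- **Symmetric special case** (`k₂ = n − k₁`, `d_x = d_z = d`, so both error types are weighted
by `2^{n−k₁} − 2^{k₁}`): if `2k₁ < n` and `2·(2^{n−k₁} − 2^{k₁})·Σ_{i=1}^{d−1} C(n,i) < 2ⁿ − 1` then
an `[[n, n − 2k₁, d]]` additive (CSS) code exists — the finite form of the Calderbank–Shor /
Steane rate `1 − 2H₂(δ)` Gilbert–Varshamov bound for CSS codes.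
[cite: Matsumoto2017, §2 Thm. 1 (chunk p0004), special case k₂ = n − k₁, d_x = d_z] -/
theorem Matsumoto2017_theorem1_symmetric {n k₁ d : ℕ} (hk : 2 * k₁ < n)
    (hgv : 2 * (2 ^ (n - k₁) - 2 ^ k₁) * ∑ i ∈ Finset.Ico 1 d, n.choose i < 2 ^ n - 1) :
    AdditiveCodeExists n (n - 2 * k₁) d := by
  have hsum : (2 ^ (n - k₁) - 2 ^ k₁) * ∑ i ∈ Finset.Ico 1 d, n.choose i +
      (2 ^ (n - k₁) - 2 ^ (n - (n - k₁))) * ∑ i ∈ Finset.Ico 1 d, n.choose i < 2 ^ n - 1 := by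
    rw [show n - (n - k₁) = k₁ by omega, ← two_mul, ← mul_assoc]
    exact hgv
  have h := Matsumoto2017_theorem1_additiveCodeExists (k₁ := k₁) (k₂ := n - k₁) (dx := d) (dz := d)
    (by omega) (by omega) hsum
  rwa [min_self, show n - k₁ - k₁ = n - 2 * k₁ by omega] at h

end Frames

end Literature.InformationTheory.QuantumCodes
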